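import Mathlib

/-!
# A2Separation — the quantitative separation of Lemma A4.2.1 and of Prop. A8.1 Step 1

Kernel-checked form of the two counting arguments of route/T4-A2-p6.md (cell pub-hodge-repro2, Tier 4,
sub-claim A2): with `a_0 ∈ O_F` primitive and `x_t := n(a_0 + t)`, the eigenvalue of `ι(x_t)^*` on the line
`ℓ_σ' ∧ ℓ_σ''` is `n²(t + σ'(a_0))(t + σ''(a_0))`, and

* Lemma A4.2.1: for each of the `3 · 14 = 42` comparisons «conjugate pair `{τ_ν, τ̄_ν}` against another
  unordered pair `{σ', σ''}`» the equation `(t + τ_ν(a_0))(t + τ̄_ν(a_0)) = (t + σ'(a_0))(t + σ''(a_0))` has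
  at most one solution `t`, so some `t ∈ {0, …, 42}` satisfies none of them;
* Prop. A8.1 Step 1: for each of the `6 · 20 = 120` comparisons «`{σ, σ}` against a multiset
  `{σ', σ''} ≠ {σ, σ}`» the equation `(t + σ(a_0))² = (t + σ'(a_0))(t + σ''(a_0))` has at most one solution,
  so some `t ∈ {0, …, 120}` satisfies none.

The algebra behind «at most one solution» is Vieta: if `(t + a)(t + b) = (t + c)(t + d)` holds for two
distinct values of `t` then `{a, b} = {c, d}` as multisets (`pair_eq_of_two_roots`); the counting is the
pigeonhole principle (`exists_le_card_forall_not`). `exists_separation_le_card` is the general statement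
(an injective `r : ι → K`, `K` a field of characteristic `0`, and any finite set `P` of comparisons of
ordered pairs which are not equal as multisets); `exists_le_42` and `exists_le_120` are the two instances
for six embeddings `Fin 6` with the conjugation `ν ↦ ν + 3`. The identification `r_σ = σ(a_0)` (distinct
because `a_0` is primitive) is the prose's first sentence and is not formalised here.
-/

namespace Summit.Ventures.HodgeRepro2.A2Separation

/-- Vieta: if `(t + a)(t + b) = (t + c)(t + d)` for two distinct values `t ≠ t'`, then the root
multisets agree: `{a, b} = {c, d}`. (The difference of the two sides is the polynomial
`(a + b − c − d) t + (ab − cd)` of degree `≤ 1` in `t`; two roots force both coefficients to vanish, and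
then `(c − a)(c − b) = c² − (a + b)c + ab = 0`.) -/
theorem pair_eq_of_two_roots {K : Type*} [Field K] {a b c d t t' : K} (htt' : t ≠ t')
    (h1 : (t + a) * (t + b) = (t + c) * (t + d))
    (h2 : (t' + a) * (t' + b) = (t' + c) * (t' + d)) :
    (a = c ∧ b = d) ∨ (a = d ∧ b = c) := by
  have hsum : a + b = c + d := by
    have h3 : (a + b - (c + d)) * (t - t') = 0 := by linear_combination h1 - h2
    rcases mul_eq_zero.1 h3 with h | h
    · linear_combination h
    · exact absurd (sub_eq_zero.1 h) htt'
  have hprod : a * b = c * d := by linear_combination h1 - t * hsum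
  have h4 : (c - a) * (c - b) = 0 := by linear_combination hprod - c * hsum
  rcases mul_eq_zero.1 h4 with h | h
  · left
    exact ⟨by linear_combination -h, by linear_combination hsum + h⟩
  · right
    exact ⟨by linear_combination hsum + h, by linear_combination -h⟩

/-- Pigeonhole: if each of finitely many «bad» conditions (indexed by `ι`) holds for at most one
natural number, then some `t ≤ card ι` satisfies none of them. -/
theorem exists_le_card_forall_not {ι : Type*} [Fintype ι] (bad : ι → ℕ → Prop)
    (h : ∀ i t t', bad i t → bad i t' → t = t') :
    ∃ t : ℕ, t ≤ Fintype.card ι ∧ ∀ i, ¬ bad i t := by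
  classical
  by_contra hcon
  push Not at hcon
  choose g hg using hcon
  let g' : Fin (Fintype.card ι + 1) → ι := fun j => g j (Nat.lt_succ_iff.mp j.2)
  have hinj : Function.Injective g' := by
    intro j k hjk
    apply Fin.ext
    have hj : bad (g' j) j := hg j _
    have hk : bad (g' j) k := by
      show bad (g' j) (k : ℕ)
      rw [hjk]
      exact hg k _
    exact h _ _ _ hj hk
  have hcard := Fintype.card_le_of_injective g' hinj
  simp only [Fintype.card_fin] at hcard
  omega

/-- The general quantitative separation: `r : ι → K` injective (`K` a field of characteristic `0`),
`P` a finite set of comparisons `((a, b), (c, d))` of ordered pairs of indices which are not equal as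
multisets. Then some `t ∈ {0, …, card P}` satisfies `(t + r a)(t + r b) ≠ (t + r c)(t + r d)` for every
comparison in `P`. -/
theorem exists_separation_le_card {K ι : Type*} [Field K] [CharZero K] [Fintype ι]
    (r : ι → K) (hr : Function.Injective r)
    (P : Finset ((ι × ι) × (ι × ι)))
    (hP : ∀ p ∈ P, ¬ (p.1.1 = p.2.1 ∧ p.1.2 = p.2.2) ∧ ¬ (p.1.1 = p.2.2 ∧ p.1.2 = p.2.1)) :
    ∃ t : ℕ, t ≤ P.card ∧ ∀ p ∈ P,
      ((t : K) + r p.1.1) * ((t : K) + r p.1.2) ≠ ((t : K) + r p.2.1) * ((t : K) + r p.2.2) := by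
  classical
  obtain ⟨t, ht, hgood⟩ := exists_le_card_forall_not (ι := P)
    (fun p t => ((t : K) + r p.1.1.1) * ((t : K) + r p.1.1.2) =
      ((t : K) + r p.1.2.1) * ((t : K) + r p.1.2.2)) (by
    intro p t t' h1 h2
    by_contra hne
    have hne' : (t : K) ≠ t' := by exact_mod_cast hne
    rcases pair_eq_of_two_roots hne' h1 h2 with ⟨h3, h4⟩ | ⟨h3, h4⟩
    · exact (hP p.1 p.2).1 ⟨hr h3, hr h4⟩
    · exact (hP p.1 p.2).2 ⟨hr h3, hr h4⟩)
  refine ⟨t, ?_, fun p hp => hgood ⟨p, hp⟩⟩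
  simpa using ht

/-- The six embeddings of the sextic field as `Fin 6`: `τ_ν := ν` for `ν : Fin 3`. -/
def tau (ν : Fin 3) : Fin 6 := ⟨ν.val, by omega⟩

/-- The conjugate embeddings: `τ̄_ν := ν + 3` for `ν : Fin 3`. -/
def taubar (ν : Fin 3) : Fin 6 := ⟨ν.val + 3, by omega⟩

/-- The index set of the comparisons of Lemma A4.2.1: `(ν, i, j)` with `i < j` and
`(i, j) ≠ (τ_ν, τ̄_ν)` (`3` choices of `ν`, `15 − 1 = 14` pairs each). -/
def indexA421 : Finset (Fin 3 × Fin 6 × Fin 6) :=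
  Finset.univ.filter (fun q => q.2.1 < q.2.2 ∧ q.2 ≠ (tau q.1, taubar q.1))

/-- The embedding `(ν, i, j) ↦ ((τ_ν, τ̄_ν), (i, j))`. -/
def embA421 : Fin 3 × Fin 6 × Fin 6 ↪ (Fin 6 × Fin 6) × (Fin 6 × Fin 6) where
  toFun q := ((tau q.1, taubar q.1), q.2)
  inj' := by
    rintro ⟨ν, i, j⟩ ⟨ν', i', j'⟩ h
    simp only [Prod.mk.injEq] at h
    obtain ⟨⟨h1, -⟩, h2, h3⟩ := h
    have h1' : (tau ν).val = (tau ν').val := congrArg Fin.val h1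
    have : ν = ν' := Fin.ext h1'
    subst this; subst h2; subst h3; rfl

/-- The `42` forbidden comparisons of Lemma A4.2.1: a conjugate pair `(τ_ν, τ̄_ν)` against an ordered
pair `i < j` which is not `(τ_ν, τ̄_ν)`. -/
def comparisonsA421 : Finset ((Fin 6 × Fin 6) × (Fin 6 × Fin 6)) := indexA421.map embA421

/-- There are exactly `42` comparisons in Lemma A4.2.1. -/
theorem card_comparisonsA421 : comparisonsA421.card = 42 := by
  rw [comparisonsA421, Finset.card_map]
  decide +kernel

/-- No comparison of Lemma A4.2.1 is an equality of multisets (`(τ_ν, τ̄_ν) ≠ (i, j)` by construction,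
and `(τ_ν, τ̄_ν) = (j, i)` would give `i = ν + 3 > ν = j`, against `i < j`). -/
theorem comparisonsA421_ne : ∀ p ∈ comparisonsA421,
    ¬ (p.1.1 = p.2.1 ∧ p.1.2 = p.2.2) ∧ ¬ (p.1.1 = p.2.2 ∧ p.1.2 = p.2.1) := by
  intro p hp
  rw [comparisonsA421, Finset.mem_map] at hp
  obtain ⟨⟨ν, i, j⟩, hq, rfl⟩ := hp
  rw [indexA421, Finset.mem_filter] at hq
  obtain ⟨-, hij, hne⟩ := hq
  simp only [embA421, Function.Embedding.coeFn_mk, tau, taubar, Fin.ext_iff, Fin.lt_def,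
    Prod.ext_iff, ne_eq] at hij hne ⊢
  omega

/-- Lemma A4.2.1, quantitative form: for six pairwise distinct values `r_σ = σ(a_0)` there is
`t ∈ {0, 1, …, 42}` such that for every `ν` and every pair `i < j` other than `(τ_ν, τ̄_ν)`,
`(t + r_{τ_ν})(t + r_{τ̄_ν}) ≠ (t + r_i)(t + r_j)`. -/
theorem exists_le_42 {K : Type*} [Field K] [CharZero K] (r : Fin 6 → K)
    (hr : Function.Injective r) :
    ∃ t : ℕ, t ≤ 42 ∧ ∀ ν : Fin 3, ∀ i j : Fin 6, i < j → (i, j) ≠ (tau ν, taubar ν) →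
      ((t : K) + r (tau ν)) * ((t : K) + r (taubar ν)) ≠ ((t : K) + r i) * ((t : K) + r j) := by
  obtain ⟨t, ht, h⟩ := exists_separation_le_card r hr comparisonsA421 comparisonsA421_ne
  rw [card_comparisonsA421] at ht
  refine ⟨t, ht, fun ν i j hij hne => ?_⟩
  have hmem : ((tau ν, taubar ν), (i, j)) ∈ comparisonsA421 :=
    Finset.mem_map.2 ⟨(ν, i, j), by simp [indexA421, hij, hne], rfl⟩
  exact h _ hmem

/-- The index set of the comparisons of Prop. A8.1 Step 1: `(σ, i, j)` with `i ≤ j` (a multiset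
`{i, j}`) and `(i, j) ≠ (σ, σ)` (`6` choices of `σ`, `21 − 1 = 20` multisets each). -/
def indexA81 : Finset (Fin 6 × Fin 6 × Fin 6) :=
  Finset.univ.filter (fun q => q.2.1 ≤ q.2.2 ∧ q.2 ≠ (q.1, q.1))

/-- The embedding `(σ, i, j) ↦ ((σ, σ), (i, j))`. -/
def embA81 : Fin 6 × Fin 6 × Fin 6 ↪ (Fin 6 × Fin 6) × (Fin 6 × Fin 6) where
  toFun q := ((q.1, q.1), q.2)
  inj' := by
    rintro ⟨σ, i, j⟩ ⟨σ', i', j'⟩ h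
    simp only [Prod.mk.injEq] at h
    obtain ⟨⟨h1, -⟩, h2, h3⟩ := h
    subst h1; subst h2; subst h3; rfl

/-- The `120` forbidden comparisons of Prop. A8.1 Step 1: `(σ, σ)` against a multiset `{i, j}`
(`i ≤ j`) other than `{σ, σ}`. -/
def comparisonsA81 : Finset ((Fin 6 × Fin 6) × (Fin 6 × Fin 6)) := indexA81.map embA81

/-- There are exactly `120` comparisons in Prop. A8.1 Step 1. -/
theorem card_comparisonsA81 : comparisonsA81.card = 120 := by
  rw [comparisonsA81, Finset.card_map]
  decide +kernel

/-- No comparison of Prop. A8.1 Step 1 is an equality of multisets. -/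
theorem comparisonsA81_ne : ∀ p ∈ comparisonsA81,
    ¬ (p.1.1 = p.2.1 ∧ p.1.2 = p.2.2) ∧ ¬ (p.1.1 = p.2.2 ∧ p.1.2 = p.2.1) := by
  intro p hp
  rw [comparisonsA81, Finset.mem_map] at hp
  obtain ⟨⟨σ, i, j⟩, hq, rfl⟩ := hp
  rw [indexA81, Finset.mem_filter] at hq
  obtain ⟨-, -, hne⟩ := hq
  simp only [embA81, Function.Embedding.coeFn_mk, Fin.ext_iff, Prod.ext_iff, ne_eq] at hne ⊢
  omega

/-- Prop. A8.1 Step 1, quantitative form: for six pairwise distinct values `r_σ = σ(a_0)` there is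
`t ∈ {0, 1, …, 120}` such that for every `σ` and every multiset `{i, j} ≠ {σ, σ}` (`i ≤ j`),
`(t + r_σ)² ≠ (t + r_i)(t + r_j)`. -/
theorem exists_le_120 {K : Type*} [Field K] [CharZero K] (r : Fin 6 → K)
    (hr : Function.Injective r) :
    ∃ t : ℕ, t ≤ 120 ∧ ∀ σ i j : Fin 6, i ≤ j → (i, j) ≠ (σ, σ) →
      ((t : K) + r σ) ^ 2 ≠ ((t : K) + r i) * ((t : K) + r j) := by
  obtain ⟨t, ht, h⟩ := exists_separation_le_card r hr comparisonsA81 comparisonsA81_ne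
  rw [card_comparisonsA81] at ht
  refine ⟨t, ht, fun σ i j hij hne => ?_⟩
  have hmem : ((σ, σ), (i, j)) ∈ comparisonsA81 :=
    Finset.mem_map.2 ⟨(σ, i, j), by simp [indexA81, hij, hne], rfl⟩
  rw [sq]
  exact h _ hmem

end Summit.Ventures.HodgeRepro2.A2Separation
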